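import Literature.Analysis.Complex.PrincipalPartAtPole
import Literature.Analysis.Complex.PolynomialLogGrowth
import Mathlib.Analysis.SpecialFunctions.Complex.Log
import HarnessLib

/-!
# Real parts of meromorphic germs along a ray cannot track a logarithm

Topic `Literature/Analysis/Complex` (namespace `Literature.Analysis.Complex.RayGrowth`).
Let `Θ` be analytic at `0`, `N ∈ ℕ`, `ζ` a direction (`|ζ| = 1`), `u` analytic at `0` with
`u(0) ≠ 0`, `ℓ` analytic at `0` and `μ ≠ 0` an integer (or real). Then it is IMPOSSIBLE that
`Re (Θ(ζρ)/(ζρ)^N) = μ · log |ζρ · u(ζρ)| + Re ℓ(ζρ · u(ζρ))`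
for real `ρ > 0` arbitrarily close to `0` (`false_of_re_eq_log_along_ray`): along the ray the
left side is `P(ρ⁻¹) + o(1)` for a real polynomial `P` (the principal part, `PrincipalPartAtPole`),
the right side is `μ log ρ + O(1)`, and power growth beats logarithmic growth
(`PolynomialLogGrowth`). This is the mechanism by which a LOG-TYPE end of an algebraic curve of
exponential points `e^{x} = y` (where `Re xⱼ = log |yⱼ|`, `yⱼ ∼ t^{μⱼ}`) carries only finitely
many such points when the relevant integer-valued meromorphic combination has a pole.
PROVED, no definition. [folklore]
-/

noncomputable section

open Complex Filter Topology Set Metric Polynomial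

namespace Literature.Analysis.Complex

namespace RayGrowth

open Literature.Analysis.Complex.PrincipalPart (exists_principal_part)
open Literature.Analysis.Complex.PolynomialLogGrowth (exists_forall_lt_abs_eval_inv_sub_mul_log)

/-- **The real part of `A((ζρ)⁻¹)` is a real polynomial in `ρ⁻¹`** (for real `ρ`). [folklore] -/
theorem exists_real_polynomial_re_eval (A : ℂ[X]) (ζ : ℂ) :
    ∃ P : ℝ[X], ∀ ρ : ℝ, (A.eval ((ζ * (ρ : ℂ))⁻¹)).re = P.eval ρ⁻¹ := by
  classical
  refine ⟨∑ k ∈ A.support, Polynomial.C ((A.coeff k * ζ⁻¹ ^ k).re) * Polynomial.X ^ k, fun ρ => ?_⟩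
  rw [Polynomial.eval_eq_sum, Polynomial.sum_def, Complex.re_sum, Polynomial.eval_finsetSum]
  refine Finset.sum_congr rfl fun k _ => ?_
  rw [Polynomial.eval_mul, Polynomial.eval_C, Polynomial.eval_pow, Polynomial.eval_X, mul_inv, mul_pow,
    ← mul_assoc]
  have : ((ρ : ℂ)⁻¹) ^ k = (((ρ⁻¹) ^ k : ℝ) : ℂ) := by push_cast; ring
  rw [this, Complex.re_mul_ofReal]

/-- Boundedness near `0` of a function continuous at `0`. [folklore] -/
theorem exists_bound_near_zero {F : ℂ → ℝ} (hF : ContinuousAt F 0) :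
    ∃ δ > 0, ∃ B : ℝ, ∀ s : ℂ, ‖s‖ < δ → |F s| ≤ B := by
  have h := Metric.continuousAt_iff.1 hF 1 one_pos
  obtain ⟨δ, hδ, hδF⟩ := h
  refine ⟨δ, hδ, |F 0| + 1, fun s hs => ?_⟩
  have := hδF (by simpa [dist_eq_norm] using hs)
  rw [Real.dist_eq] at this
  have h2 : |F s| - |F 0| ≤ |F s - F 0| := abs_sub_abs_le_abs_sub _ _
  linarith

/-- **No logarithmic tracking along a ray.** Let `Θ, u, ℓ` be analytic at `0`, `u 0 ≠ 0`, `N ∈ ℕ`,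
`|ζ| = 1`, `μ ≠ 0`. If for real `ρ > 0` arbitrarily close to `0`
`Re (Θ(ζρ)/(ζρ)^N) = μ log |ζρ u(ζρ)| + Re ℓ(ζρ u(ζρ))`, we reach a contradiction. [folklore] -/
theorem false_of_re_eq_log_along_ray {Θ u ℓ : ℂ → ℂ} (hΘ : AnalyticAt ℂ Θ 0) (hu : AnalyticAt ℂ u 0)
    (hu0 : u 0 ≠ 0) (hℓ : AnalyticAt ℂ ℓ 0) (N : ℕ) {ζ : ℂ} (hζ : ‖ζ‖ = 1) {μ : ℝ} (hμ : μ ≠ 0)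
    (h : ∀ δ > 0, ∃ ρ : ℝ, 0 < ρ ∧ ρ < δ ∧
      (Θ (ζ * ρ) / (ζ * ρ) ^ N).re =
        μ * Real.log ‖ζ * ρ * u (ζ * ρ)‖ + (ℓ (ζ * ρ * u (ζ * ρ))).re) : False := by
  -- principal part of `Θ(s)/s^N`
  obtain ⟨A, g, hg, hg0, -, hpp⟩ := exists_principal_part hΘ N
  obtain ⟨P, hP⟩ := exists_real_polynomial_re_eval A ζ
  obtain ⟨δ₁, hδ₁, hpp'⟩ :=
    (Metric.nhdsWithin_basis_ball (s := ({0}ᶜ : Set ℂ)) (x := 0)).eventually_iff.1 hpp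
  -- `u ≠ 0` near `0`
  obtain ⟨δ₀, hδ₀, hune⟩ : ∃ δ₀ > 0, ∀ s : ℂ, ‖s‖ < δ₀ → u s ≠ 0 := by
    obtain ⟨δ₀, hδ₀, h0⟩ := Metric.eventually_nhds_iff.1 (hu.continuousAt.eventually_ne hu0)
    exact ⟨δ₀, hδ₀, fun s hs => h0 (by simpa [dist_eq_norm] using hs)⟩
  -- bounded error terms
  have hcg : ContinuousAt (fun s : ℂ => (g s).re) 0 :=
    Complex.continuous_re.continuousAt.comp hg.continuousAt
  have hcu : ContinuousAt (fun s : ℂ => Real.log ‖u s‖) 0 :=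
    (continuous_norm.continuousAt.comp hu.continuousAt).log (by simpa using hu0)
  have hcℓ : ContinuousAt (fun s : ℂ => (ℓ (s * u s)).re) 0 := by
    have h1 : ContinuousAt (fun s : ℂ => s * u s) 0 := continuousAt_id.mul hu.continuousAt
    have h2 : ContinuousAt ℓ ((fun s : ℂ => s * u s) 0) := by simpa using hℓ.continuousAt
    exact Complex.continuous_re.continuousAt.comp (ContinuousAt.comp (g := ℓ) h2 h1)
  obtain ⟨δg, hδg, Bg, hBg⟩ := exists_bound_near_zero hcg
  obtain ⟨δu, hδu, Bu, hBu⟩ := exists_bound_near_zero hcu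
  obtain ⟨δℓ, hδℓ, Bℓ, hBℓ⟩ := exists_bound_near_zero hcℓ
  set B : ℝ := |μ| * Bu + Bℓ + Bg with hB
  obtain ⟨δ₂, hδ₂, hgrow⟩ := exists_forall_lt_abs_eval_inv_sub_mul_log P hμ B
  -- a small `ρ`
  obtain ⟨ρ, hρ, hρδ, heq⟩ := h (min δ₀ (min δ₁ (min δ₂ (min δg (min δu δℓ)))))
    (lt_min hδ₀ (lt_min hδ₁ (lt_min hδ₂ (lt_min hδg (lt_min hδu hδℓ)))))
  simp only [lt_min_iff] at hρδ
  obtain ⟨hρ₀, hρ₁, hρ₂, hρg, hρu, hρℓ⟩ := hρδ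
  have hs : ‖(ζ * ρ : ℂ)‖ = ρ := by
    rw [norm_mul, hζ, one_mul, Complex.norm_real, Real.norm_eq_abs, abs_of_pos hρ]
  have hs0 : (ζ * ρ : ℂ) ≠ 0 := by
    intro h0; rw [h0, norm_zero] at hs; linarith
  -- the identity at `ρ`
  have hmain := hpp' ⟨by rw [mem_ball_zero_iff, hs]; exact hρ₁, hs0⟩
  have hu' : u (ζ * ρ) ≠ 0 := hune _ (by rw [hs]; exact hρ₀)
  have hnorm : Real.log ‖ζ * ρ * u (ζ * ρ)‖ = Real.log ρ + Real.log ‖u (ζ * ρ)‖ := by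
    rw [norm_mul, hs, Real.log_mul hρ.ne' (norm_ne_zero_iff.2 hu')]
  rw [hmain, Complex.add_re, hP ρ, hnorm] at heq
  have hg' := hBg (ζ * ρ) (by rw [hs]; exact hρg)
  have hu'' := hBu (ζ * ρ) (by rw [hs]; exact hρu)
  have hℓ' := hBℓ (ζ * ρ) (by rw [hs]; exact hρℓ)
  have hgr := hgrow ρ hρ hρ₂
  have hident : P.eval ρ⁻¹ - μ * Real.log ρ =
      μ * Real.log ‖u (ζ * ρ)‖ + (ℓ (ζ * ρ * u (ζ * ρ))).re - (g (ζ * ρ)).re := by linarith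
  rw [hident] at hgr
  have h1 := abs_sub (μ * Real.log ‖u (ζ * ρ)‖ + (ℓ (ζ * ρ * u (ζ * ρ))).re) ((g (ζ * ρ)).re)
  have h2 := abs_add_le (μ * Real.log ‖u (ζ * ρ)‖) ((ℓ (ζ * ρ * u (ζ * ρ))).re)
  have h3 : |μ * Real.log ‖u (ζ * ρ)‖| ≤ |μ| * Bu := by
    rw [abs_mul]; exact mul_le_mul_of_nonneg_left hu'' (abs_nonneg μ)
  linarith

end RayGrowth

end Literature.Analysis.Complex

end
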